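import Literature.AlgebraicGeometry.HodgeTheory.SymmetricA3MonodromyRelations
import HarnessLib

/-!
# Picard–Lefschetz data transported by an isometry-conjugation of the monodromy (programme «PL2-MERIDIANS»)

Family `hodge`, layer `Literature/AlgebraicGeometry/HodgeTheory`. Theorems only. Written by the prover seat
`hodge-nonav-20241-p1` (g18, cell `hodge-nonav`) for the registry binder hPL₂exch = `picardLefschetz_exchangedPair`
(crux K1-B, stmt-HodgeConjecture-19716).

When a symmetry `σ′` of the fibre `Y_s` conjugates the loop `γ` into a loop `γ′` at the same base point — the
transport along `γ′` being `x ↦ R (T (R⁻¹ x))` with `T` the transport along `γ` and `R` an ISOMETRY of the middle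
pairing `B(x, y) = tr(x ∪ y)` (e.g. `R = σ′^*`, a monodromy of the diagonal torus, `DiagonalTorusMonodromy`) —
Picard–Lefschetz data `(δ; c)` for `γ` give Picard–Lefschetz data `(R ∘ δ; c)` for `γ′` with the SAME coefficient:
`R(T(R⁻¹x)) = x + c Σᵢ B(R⁻¹x, δᵢ) Rδᵢ = x + c Σᵢ B(x, Rδᵢ) Rδᵢ`. This is the algebra behind the exchange clause
`σ′^* δ₀ = δ₁` of `picardLefschetz_exchangedPair` in programme PL2-MERIDIANS (the second one-node meridian is the
`σ′`-image of the first).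

* `IsPicardLefschetzData.of_isometry_conj` — the statement above (any number `k` of cycles).

Honest scope: pure algebra on the predicate `IsPicardLefschetzData`; nothing here proves hPL₂exch or HC.

## References

* [VoisinHodgeII2003] C. Voisin, Hodge Theory and Complex Algebraic Geometry II, CUP 2003, §3.2.1 Thm. 3.16,
  Rem. 3.21; §2.2.1 Def. 2.12 (vanishing cycles up to sign; transport of Milnor balls by symmetries).
-/

noncomputable section

open CategoryTheory AlgebraicGeometry MvPolynomial
open Literature.AlgebraicTopology.SingularHomology
open Literature.AlgebraicGeometry.Motives Literature.AlgebraicGeometry.Motives.UniversalHypersurface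
open Literature.AlgebraicGeometry.HodgeTheory.BettiUniverse

namespace Literature.AlgebraicGeometry.HodgeTheory

variable {n d k : ℕ} {hn : 1 ≤ n} {hd : 1 ≤ d}
  {hU : IsCohomologicallyLocallyTrivialOn (family ℂ n d) Set.univ} {s : ComplexPoints (base ℂ n d)}
  {γ γ' : Path s s} {c : ℚ} {δ : Fin k → bettiCohomology (fiberOver (family ℂ n d) s) n}
  {T : bettiCohomology (fiberOver (family ℂ n d) s) n ≃ₗ[ℚ] bettiCohomology (fiberOver (family ℂ n d) s) n}

/-- **Picard–Lefschetz data under an isometry-conjugation of the monodromy.** If `(δ; c)` are Picard–Lefschetz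
data for `γ` (transport `T` in degree `n`), `R` is an isometry of `B = tr ∘ ∪` on `Hⁿ(Y_s; ℚ)`, and the rational
transport along `γ′` is `x ↦ R (T (R⁻¹ x))` in degree `n` and the identity in the other degrees, then
`(R ∘ δ; c)` are Picard–Lefschetz data for `γ′`. [cite: VoisinHodgeII2003, §3.2.1 Thm. 3.16, Rem. 3.21 and §2.2.1 Def. 2.12] -/
theorem IsPicardLefschetzData.of_isometry_conj
    (R : bettiCohomology (fiberOver (family ℂ n d) s) n ≃ₗ[ℚ] bettiCohomology (fiberOver (family ℂ n d) s) n)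
    (h : IsPicardLefschetzData n d k hn hd hU γ δ c)
    (hT : IsRatTransport (family ℂ n d) n hU (loopClassUniv n d γ) T)
    (hR : ∀ x y, tr ((isSmoothProjectiveFamily_family ℂ hn hd).isSmoothProjective s) (n + n)
        (cup (fiberOver (family ℂ n d) s) n n (R x) (R y)) =
      tr ((isSmoothProjectiveFamily_family ℂ hn hd).isSmoothProjective s) (n + n)
        (cup (fiberOver (family ℂ n d) s) n n x y))
    (hT' : IsRatTransport (family ℂ n d) n hU (loopClassUniv n d γ') (R.symm.trans (T.trans R)))
    (hoff : ∀ k', k' ≠ n → IsRatTransport (family ℂ n d) k' hU (loopClassUniv n d γ') (LinearEquiv.refl ℚ _)) :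
    IsPicardLefschetzData n d k hn hd hU γ' (fun i => R (δ i)) c := by
  obtain ⟨hc, horth, ⟨T₀, hT₀, hT₀x⟩, -, heven, hodd⟩ := h
  have e0 : T₀ = T := isRatTransport_unique_family hT₀ hT
  rw [e0] at hT₀x
  set hX := (isSmoothProjectiveFamily_family ℂ hn hd).isSmoothProjective s with hXdef
  set Bl : bettiCohomology (fiberOver (family ℂ n d) s) n →ₗ[ℚ] bettiCohomology (fiberOver (family ℂ n d) s) n →ₗ[ℚ] ℚ :=
    (cup (fiberOver (family ℂ n d) s) n n).compr₂ (tr hX (n + n)) with hBl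
  have hR' : ∀ x y, Bl (R x) (R y) = Bl x y := fun x y => hR x y
  -- `B(R⁻¹ x, y) = B(x, R y)`
  have hRsymm : ∀ x y, Bl (R.symm x) y = Bl x (R y) := fun x y => by
    conv_rhs => rw [← R.apply_symm_apply x]
    exact (hR' (R.symm x) y).symm
  refine ⟨hc, fun i i' hii' => ?_, ⟨R.symm.trans (T.trans R), hT', fun x => ?_⟩, hoff, fun hev i => ?_, fun hod i => ?_⟩
  · -- orthogonality is preserved
    change Bl (R (δ i)) (R (δ i')) = 0
    rw [hR']; exact horth i i' hii'
  · -- the formula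
    rw [LinearEquiv.trans_apply, LinearEquiv.trans_apply, hT₀x (R.symm x), map_add, LinearEquiv.apply_symm_apply,
      map_smul, map_sum]
    congr 1
    congr 1
    refine Finset.sum_congr rfl fun i _ => ?_
    rw [map_smul]
    congr 1
    exact hRsymm x (δ i)
  · obtain ⟨h2, hne⟩ := heven hev i
    refine ⟨?_, fun h0 => hne (R.injective (by rw [map_zero]; exact h0))⟩
    change c * Bl (R (δ i)) (R (δ i)) = -2
    rw [hR']; exact h2
  · change Bl (R (δ i)) (R (δ i)) = 0
    rw [hR']; exact hodd hod i

end Literature.AlgebraicGeometry.HodgeTheory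

end
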